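import Mathlib.NumberTheory.Bertrand
import Mathlib.NumberTheory.Chebyshev
import Literature.NumberTheory.LFunctions.ColossallyAbundantQuotient
import HarnessLib

/-!
# Exponents of a colossally abundant number (Alaoglu–Erdős 1944, §3; Robin 1984, §3)

Topic: `Literature/NumberTheory/LFunctions`. Pure proof file (no new definition, nothing
asserted) serving provefact `Literature.NumberTheory.LFunctions.robin_iff`: the elementary structure of the prime
factorisation `N = ∏ p^{a_p}` of a number `N` admitting a parameter `ε > 0`
(`Nat.IsCAParameter ε N`, i.e. `N` maximises `m ↦ σ(m)/m^{1+ε}`; every colossally abundant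
number does), in the shape consumed by Robin's proof of `RH ⇒ σ(N) < e^γ N log log N` at
colossally abundant `N` (Robin 1984, §3: "`σ(N)/N ≤ ∏_{x₂ < p ≤ x} (1 − 1/p²) ∏_{p ≤ x} (1 − 1/p)⁻¹`",
`x = x₁` the largest prime factor, `x₂` the largest prime with exponent `≥ 2`).

Writing `a_p = N.factorization p`, `P` for the largest prime factor and `T(p, a) =
σ(p^{a+1})/σ(p^a) = p + 1/σ(p^a)` (Erdős–Nicolas), local optimality
(`Nat.IsCAParameter.sigma_div_le_rpow`, `Nat.IsCAParameter.rpow_le_sigma_div` of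
`ColossallyAbundantQuotient.lean`) reads `T(p, a_p) ≤ p^{1+ε} ≤ T(p, a_p − 1)`. We derive:

* `IsCAParameter.dvd_of_prime_le` — every prime `q ≤ P` divides `N` (the primes of `N` form an
  initial segment; Alaoglu–Erdős 1944, Thm. 10 area, p. 455), because
  `t ↦ log(1 + 1/t)/log t` is decreasing;
* `IsCAParameter.factorization_antitone` — `p ≤ q ⟹ a_q ≤ a_p` (exponents are non-increasing
  along the primes);
* `IsCAParameter.pow_factorization_mul_le_one` — `p^{a_p} · ε log p ≤ 1`, and
  `IsCAParameter.inv_le_eps` — `1/((q+1) log q) ≤ ε` for a prime `q ∤ N`; with Bertrand's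
  postulate, `ε ≥ 1/((2P+1) log 2P)`;
* `ColossallyAbundant.exists_structure` — the package: `ε, P, Q` with
  `N.primeFactors = primesLE P`, `a_p ≥ 2` exactly for the primes `p ≤ Q` (`1 ≤ Q ≤ P`;
  `Q = 1` when `N` is squarefree), and the three estimates
  `σ(N)/N ≤ (∏_{p ≤ P} (1 − 1/p))⁻¹ · ∏_{Q < p ≤ P} (1 − 1/p²)`,
  `θ(P) + θ(Q) ≤ log N`, and `log N ≤ θ(P) + √u · log u` with `u = (2P+1) log(2P)/log 2`
  (the last one only bounds the size of `N` by its largest prime; it is what confines the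
  colossally abundant numbers below Briggs's `10^(10^10)` to `P < 2·10^{10}` in the sibling file
  `RobinColossallyAbundantRH.lean`).

## References

* L. Alaoglu, P. Erdős, Trans. AMS 56 (1944), 448–469, §3. [AlaogluErdos1944]
* P. Erdős, J.-L. Nicolas, Bull. SMF 103 (1975), 65–90, Prop. 3. [ErdosNicolas1975]
* G. Robin, J. Math. Pures Appl. 63 (1984), 187–213, §3 (the bound for `σ(N)/N`, `x₁`, `x₂`).
  [Robin1984]
-/

noncomputable section

open Real Finset
open scoped ArithmeticFunction.sigma Chebyshev

namespace Nat

/-! ### The local factor `σ(p^a)/p^a` -/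

/-- `σ(p^a) · (1 − 1/p) = p^a − p^{-1}·1 ≤ p^a`, i.e. `σ(p^a)/p^a ≤ (1 − 1/p)⁻¹`. [folklore] -/
theorem sigma_one_prime_pow_mul_le {p : ℕ} (hp : p.Prime) (a : ℕ) :
    (σ 1 (p ^ a) : ℝ) * (1 - (p : ℝ)⁻¹) ≤ (p : ℝ) ^ a := by
  have hp0 : (0 : ℝ) < p := by exact_mod_cast hp.pos
  rw [ArithmeticFunction.sigma_one_apply_prime_pow hp]
  push_cast
  have hgeom : (∑ i ∈ range (a + 1), (p : ℝ) ^ i) * ((p : ℝ) - 1) = (p : ℝ) ^ (a + 1) - 1 :=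
    geom_sum_mul _ _
  have h1 : (∑ i ∈ range (a + 1), (p : ℝ) ^ i) * (1 - (p : ℝ)⁻¹) =
      ((p : ℝ) ^ (a + 1) - 1) / p := by
    rw [← hgeom]
    field_simp
  rw [h1, div_le_iff₀ hp0, pow_succ]
  linarith

/-- `σ(p^a)/p^a ≤ (1 − 1/p)⁻¹`. [folklore] -/
theorem sigma_one_prime_pow_div_le {p : ℕ} (hp : p.Prime) (a : ℕ) :
    (σ 1 (p ^ a) : ℝ) / (p : ℝ) ^ a ≤ (1 - (p : ℝ)⁻¹)⁻¹ := by
  have hp1 : (1 : ℝ) < p := by exact_mod_cast hp.one_lt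
  have hq : 0 < 1 - (p : ℝ)⁻¹ := by
    have : (p : ℝ)⁻¹ < 1 := inv_lt_one_of_one_lt₀ hp1
    linarith
  have hpa : (0 : ℝ) < (p : ℝ) ^ a := by positivity
  rw [div_le_iff₀ hpa, inv_mul_eq_div, le_div_iff₀ hq]
  exact sigma_one_prime_pow_mul_le hp a

/-- For the first power the local factor is exactly `σ(p)/p = 1 + 1/p = (1 − 1/p)⁻¹ (1 − 1/p²)`.
[folklore] -/
theorem sigma_one_prime_div_eq {p : ℕ} (hp : p.Prime) :
    (σ 1 (p ^ 1) : ℝ) / (p : ℝ) ^ 1 = (1 - (p : ℝ)⁻¹)⁻¹ * (1 - ((p : ℝ) ^ 2)⁻¹) := by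
  have hp0 : (0 : ℝ) < p := by exact_mod_cast hp.pos
  have hp1 : (1 : ℝ) < p := by exact_mod_cast hp.one_lt
  have hq : (p : ℝ) - 1 ≠ 0 := by linarith
  rw [ArithmeticFunction.sigma_one_apply_prime_pow hp, pow_one]
  push_cast
  rw [Finset.sum_range_succ, Finset.sum_range_succ, Finset.sum_range_zero]
  field_simp
  ring

/-- `σ` is monotone along divisibility: `d ∣ n ⟹ σ(d) ≤ σ(n)`. [folklore] -/
theorem sigma_one_le_of_dvd {d n : ℕ} (hn : n ≠ 0) (h : d ∣ n) : σ 1 d ≤ σ 1 n := by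
  rw [ArithmeticFunction.sigma_one_apply, ArithmeticFunction.sigma_one_apply]
  exact Finset.sum_le_sum_of_subset (Nat.divisors_subset_of_dvd hn h)

/-- `σ(p^a) ≤ σ(q^a)` for `p ≤ q`. [folklore] -/
theorem sigma_one_prime_pow_le_of_le {p q : ℕ} (hp : p.Prime) (hq : q.Prime) (hpq : p ≤ q) (a : ℕ) :
    σ 1 (p ^ a) ≤ σ 1 (q ^ a) := by
  rw [ArithmeticFunction.sigma_one_apply_prime_pow hp, ArithmeticFunction.sigma_one_apply_prime_pow hq]
  exact Finset.sum_le_sum fun i _ => Nat.pow_le_pow_left hpq i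

/-! ### Local optimality in usable form

For `N` with parameter `ε` (`Nat.IsCAParameter ε N`): at a prime `q ∤ N` one cannot go up,
`1 + 1/q ≤ q^ε`; at a prime `p ∣ N` one cannot go down, `p^ε ≤ 1 + 1/(p σ(p^{a_p - 1}))`. -/

variable {ε : ℝ} {N : ℕ}

/-- If a prime `q` does not divide `N` then `T(q, 0) = q + 1 ≤ q^{1+ε}`, i.e. `1 + 1/q ≤ q^ε`
(Erdős–Nicolas 1975, Prop. 3 at exponent `0`). [cite: ErdosNicolas1975, Prop. 3, p. 69] -/
theorem IsCAParameter.one_add_inv_le_rpow (h : IsCAParameter ε N) (hN : N ≠ 0) {q : ℕ}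
    (hq : q.Prime) (hqN : ¬ q ∣ N) : 1 + (q : ℝ)⁻¹ ≤ (q : ℝ) ^ ε := by
  have h1 := h.sigma_div_le_rpow hN hq
  rw [Nat.factorization_eq_zero_of_not_dvd hqN, sigma_prime_pow_succ_div hq 0, pow_zero,
    ArithmeticFunction.isMultiplicative_sigma.map_one] at h1
  have hq0 : (0 : ℝ) < q := by exact_mod_cast hq.pos
  rw [Real.rpow_add hq0, Real.rpow_one] at h1
  refine le_of_mul_le_mul_left ?_ hq0
  calc (q : ℝ) * (1 + (q : ℝ)⁻¹) = q + 1 / ((1 : ℕ) : ℝ) := by push_cast; field_simp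
    _ ≤ q * (q : ℝ) ^ ε := h1

/-- If a prime `p` divides `N` then `p^{1+ε} ≤ T(p, a_p − 1) = p + 1/σ(p^{a_p−1})`, i.e.
`p^ε ≤ 1 + 1/(p σ(p^{a_p−1}))` (Erdős–Nicolas 1975, Prop. 3). [cite: ErdosNicolas1975, Prop. 3, p. 69] -/
theorem IsCAParameter.rpow_le_one_add (h : IsCAParameter ε N) (hN : N ≠ 0) {p : ℕ} (hp : p.Prime)
    (hpN : p ∣ N) :
    (p : ℝ) ^ ε ≤ 1 + ((p : ℝ) * σ 1 (p ^ (N.factorization p - 1)))⁻¹ := by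
  obtain ⟨m, hm⟩ := hpN
  have hm0 : m ≠ 0 := by
    rintro rfl
    exact hN (by simpa using hm)
  have h' : IsCAParameter ε (p * m) := hm ▸ h
  have h1 := h'.rpow_le_sigma_div hm0 hp
  have hfac : N.factorization p - 1 = m.factorization p := by
    rw [hm, Nat.factorization_mul hp.ne_zero hm0, Finsupp.add_apply, hp.factorization_self]
    omega
  rw [hfac]
  rw [sigma_prime_pow_succ_div hp] at h1
  have hp0 : (0 : ℝ) < p := by exact_mod_cast hp.pos
  rw [Real.rpow_add hp0, Real.rpow_one] at h1
  refine le_of_mul_le_mul_left ?_ hp0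
  have hs : (0 : ℝ) < σ 1 (p ^ m.factorization p) := by
    exact_mod_cast one_le_sigma_one_prime_pow hp _
  calc (p : ℝ) * (p : ℝ) ^ ε ≤ p + 1 / σ 1 (p ^ m.factorization p) := h1
    _ = p * (1 + ((p : ℝ) * σ 1 (p ^ m.factorization p))⁻¹) := by field_simp

/-- If a prime `p` divides `N` then `p^ε ≤ 1 + 1/p`. [cite: ErdosNicolas1975, Prop. 3, p. 69] -/
theorem IsCAParameter.rpow_le_one_add_inv (h : IsCAParameter ε N) (hN : N ≠ 0) {p : ℕ}
    (hp : p.Prime) (hpN : p ∣ N) : (p : ℝ) ^ ε ≤ 1 + (p : ℝ)⁻¹ := by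
  have hs : (1 : ℝ) ≤ σ 1 (p ^ (N.factorization p - 1)) := by
    exact_mod_cast one_le_sigma_one_prime_pow hp _
  have hp0 : (0 : ℝ) < p := by exact_mod_cast hp.pos
  have h1 : ((p : ℝ) * σ 1 (p ^ (N.factorization p - 1)))⁻¹ ≤ (p : ℝ)⁻¹ :=
    inv_anti₀ hp0 (le_mul_of_one_le_right hp0.le hs)
  linarith [h.rpow_le_one_add hN hp hpN]

/-- **Size of the prime powers of `N`**: if `p ∣ N` then `p^{a_p} · ε log p ≤ 1`, i.e.
`p^{a_p} ≤ 1/(ε log p)` (from `p^ε ≤ 1 + 1/(pσ(p^{a_p−1})) ≤ 1 + p^{−a_p}` and `log(1+u) ≤ u`;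
Alaoglu–Erdős 1944, (16)–(17) area; Robin 1984, §3, `x_k`). [cite: AlaogluErdos1944, §3] -/
theorem IsCAParameter.pow_factorization_mul_le_one (h : IsCAParameter ε N) (hN : N ≠ 0) {p : ℕ}
    (hp : p.Prime) (hpN : p ∣ N) :
    (p : ℝ) ^ N.factorization p * (ε * Real.log p) ≤ 1 := by
  set a := N.factorization p with ha
  have ha1 : 1 ≤ a := hp.factorization_pos_of_dvd hN hpN
  have hp0 : (0 : ℝ) < p := by exact_mod_cast hp.pos
  have hs : (p : ℝ) ^ (a - 1) ≤ σ 1 (p ^ (a - 1)) := by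
    have : p ^ (a - 1) ≤ σ 1 (p ^ (a - 1)) := by
      rw [ArithmeticFunction.sigma_one_apply]
      exact Finset.single_le_sum (fun d _ => Nat.zero_le d)
        (Nat.mem_divisors_self _ (pow_ne_zero _ hp.ne_zero))
    exact_mod_cast this
  have h1 := h.rpow_le_one_add hN hp hpN
  have hpa' : (0 : ℝ) < (p : ℝ) ^ a := by positivity
  have h2' : ((p : ℝ) * σ 1 (p ^ (a - 1)))⁻¹ ≤ ((p : ℝ) ^ a)⁻¹ := by
    refine inv_anti₀ hpa' ?_
    calc (p : ℝ) ^ a = p * (p : ℝ) ^ (a - 1) := by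
          conv_lhs => rw [← Nat.sub_add_cancel ha1, _root_.pow_succ']
      _ ≤ p * σ 1 (p ^ (a - 1)) := by gcongr
  have h2 : (p : ℝ) ^ ε ≤ 1 + ((p : ℝ) ^ a)⁻¹ := by linarith
  have h3 : ε * Real.log p ≤ ((p : ℝ) ^ a)⁻¹ := by
    rw [← Real.log_rpow hp0 ε]
    have hpos : 0 < (p : ℝ) ^ ε := Real.rpow_pos_of_pos hp0 ε
    calc Real.log ((p : ℝ) ^ ε) ≤ Real.log (1 + ((p : ℝ) ^ a)⁻¹) := Real.log_le_log hpos h2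
      _ ≤ (1 + ((p : ℝ) ^ a)⁻¹) - 1 := Real.log_le_sub_one_of_pos (by positivity)
      _ = ((p : ℝ) ^ a)⁻¹ := by ring
  have hpa : (0 : ℝ) < (p : ℝ) ^ a := by positivity
  calc (p : ℝ) ^ a * (ε * Real.log p) ≤ (p : ℝ) ^ a * ((p : ℝ) ^ a)⁻¹ := by gcongr
    _ = 1 := mul_inv_cancel₀ hpa.ne'

/-- **Lower bound for the parameter**: if a prime `q` does not divide `N` then
`1/((q+1) log q) ≤ ε` (from `1 + 1/q ≤ q^ε` and `log(1 + 1/q) ≥ 1/(q+1)`).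
[cite: ErdosNicolas1975, Prop. 3, p. 69] -/
theorem IsCAParameter.inv_le_eps (h : IsCAParameter ε N) (hN : N ≠ 0) {q : ℕ} (hq : q.Prime)
    (hqN : ¬ q ∣ N) : 1 / (((q : ℝ) + 1) * Real.log q) ≤ ε := by
  have hq0 : (0 : ℝ) < q := by exact_mod_cast hq.pos
  have hq1 : (1 : ℝ) < q := by exact_mod_cast hq.one_lt
  have hlogq : 0 < Real.log q := Real.log_pos hq1
  have h1 := h.one_add_inv_le_rpow hN hq hqN
  have h2 : Real.log (1 + (q : ℝ)⁻¹) ≤ ε * Real.log q := by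
    rw [← Real.log_rpow hq0]
    exact Real.log_le_log (by positivity) h1
  have h3 : 1 / ((q : ℝ) + 1) ≤ Real.log (1 + (q : ℝ)⁻¹) := by
    have := Real.one_sub_inv_le_log_of_pos (x := 1 + (q : ℝ)⁻¹) (by positivity)
    convert this using 1
    field_simp
    ring
  calc 1 / (((q : ℝ) + 1) * Real.log q) = 1 / ((q : ℝ) + 1) / Real.log q := by rw [div_div]
    _ ≤ ε * Real.log q / Real.log q := div_le_div_of_nonneg_right (h3.trans h2) hlogq.le
    _ = ε := by field_simp

/-! ### The primes of `N` form an initial segment, with non-increasing exponents -/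

/-- **Initial segment** (Alaoglu–Erdős 1944, §3): if a prime `P` divides `N` (parameter
`ε > 0`), so does every prime `q ≤ P` — otherwise `1 + 1/q ≤ q^ε < P^ε ≤ 1 + 1/P`.
[cite: AlaogluErdos1944, §3] -/
theorem IsCAParameter.dvd_of_prime_le (h : IsCAParameter ε N) (hε : 0 < ε) (hN : N ≠ 0) {P q : ℕ}
    (hP : P.Prime) (hPN : P ∣ N) (hq : q.Prime) (hqP : q ≤ P) : q ∣ N := by
  by_contra hqN
  have hqP' : q < P := lt_of_le_of_ne hqP (by rintro rfl; exact hqN hPN)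
  have h1 := h.one_add_inv_le_rpow hN hq hqN
  have h2 := h.rpow_le_one_add_inv hN hP hPN
  have hq0 : (0 : ℝ) < q := by exact_mod_cast hq.pos
  have hP0 : (0 : ℝ) < P := by exact_mod_cast hP.pos
  have h3 : (q : ℝ) ^ ε < (P : ℝ) ^ ε :=
    Real.rpow_lt_rpow hq0.le (by exact_mod_cast hqP') hε
  have h4 : (q : ℝ)⁻¹ < (P : ℝ)⁻¹ := by linarith
  have h5 : (P : ℝ) < q := (inv_lt_inv₀ hq0 hP0).1 h4
  exact absurd h5 (not_lt.2 (by exact_mod_cast hqP))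

/-- **Exponents do not increase** (Alaoglu–Erdős 1944, §3; Erdős–Nicolas 1975, Prop. 3): for
primes `p ≤ q`, `a_q ≤ a_p` — otherwise `1 + 1/(pσ(p^{a_p})) ≤ p^ε < q^ε ≤ 1 + 1/(qσ(q^{a_q−1}))`
while `qσ(q^{a_q−1}) ≥ qσ(q^{a_p}) > pσ(p^{a_p})`. [cite: AlaogluErdos1944, §3] -/
theorem IsCAParameter.factorization_antitone (h : IsCAParameter ε N) (hε : 0 < ε) (hN : N ≠ 0)
    {p q : ℕ} (hp : p.Prime) (hq : q.Prime) (hpq : p ≤ q) :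
    N.factorization q ≤ N.factorization p := by
  rcases hpq.eq_or_lt with rfl | hpq'
  · exact le_rfl
  by_contra hlt
  push Not at hlt
  set a := N.factorization p with ha
  set b := N.factorization q with hb
  have hb1 : 1 ≤ b := by omega
  have hqN : q ∣ N := Nat.dvd_of_factorization_pos (by omega)
  have hp0 : (0 : ℝ) < p := by exact_mod_cast hp.pos
  have hq0 : (0 : ℝ) < q := by exact_mod_cast hq.pos
  -- cannot go up at `p`
  have h1 := h.sigma_div_le_rpow hN hp
  rw [sigma_prime_pow_succ_div hp, Real.rpow_add hp0, Real.rpow_one] at h1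
  have hsa : (0 : ℝ) < σ 1 (p ^ a) := by exact_mod_cast one_le_sigma_one_prime_pow hp _
  have h1' : 1 + ((p : ℝ) * σ 1 (p ^ a))⁻¹ ≤ (p : ℝ) ^ ε := by
    refine le_of_mul_le_mul_left ?_ hp0
    calc (p : ℝ) * (1 + ((p : ℝ) * σ 1 (p ^ a))⁻¹) = p + 1 / σ 1 (p ^ a) := by field_simp
      _ ≤ p * (p : ℝ) ^ ε := h1
  -- cannot go down at `q`
  have h2 := h.rpow_le_one_add hN hq hqN
  have h3 : (p : ℝ) ^ ε < (q : ℝ) ^ ε := Real.rpow_lt_rpow hp0.le (by exact_mod_cast hpq') hε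
  have h4 : ((p : ℝ) * σ 1 (p ^ a))⁻¹ < ((q : ℝ) * σ 1 (q ^ (b - 1)))⁻¹ := by
    have := h1'.trans_lt (h3.trans_le h2)
    linarith
  have hsb : (0 : ℝ) < σ 1 (q ^ (b - 1)) := by exact_mod_cast one_le_sigma_one_prime_pow hq _
  have h5 : (q : ℝ) * σ 1 (q ^ (b - 1)) < (p : ℝ) * σ 1 (p ^ a) :=
    (inv_lt_inv₀ (by positivity) (by positivity)).1 h4
  -- but `σ(p^a) ≤ σ(q^a) ≤ σ(q^{b-1})` and `p < q`
  have h6 : σ 1 (p ^ a) ≤ σ 1 (q ^ (b - 1)) :=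
    (sigma_one_prime_pow_le_of_le hp hq hpq a).trans
      (sigma_one_le_of_dvd (pow_ne_zero _ hq.ne_zero) (pow_dvd_pow q (by omega)))
  have h6' : (σ 1 (p ^ a) : ℝ) ≤ σ 1 (q ^ (b - 1)) := by exact_mod_cast h6
  have hpq_cast : (p : ℝ) ≤ q := by exact_mod_cast hpq
  have h7 : (p : ℝ) * σ 1 (p ^ a) ≤ (q : ℝ) * σ 1 (q ^ (b - 1)) :=
    mul_le_mul hpq_cast h6' hsa.le hq0.le
  linarith

/-! ### The prime factorisation: `σ(N)/N`, `log N` -/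

/-- Each factor `1 − 1/p` (`p` prime) is positive. [folklore] -/
theorem one_sub_inv_pos_of_prime {p : ℕ} (hp : p.Prime) : 0 < 1 - (p : ℝ)⁻¹ := by
  have hp1 : (1 : ℝ) < p := by exact_mod_cast hp.one_lt
  have : (p : ℝ)⁻¹ < 1 := inv_lt_one_of_one_lt₀ hp1
  linarith

/-- Each factor `1 − 1/p²` (`p` prime) is positive. [folklore] -/
theorem one_sub_inv_sq_pos_of_prime {p : ℕ} (hp : p.Prime) : 0 < 1 - ((p : ℝ) ^ 2)⁻¹ := by
  have hp1 : (1 : ℝ) < (p : ℝ) ^ 2 := by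
    have : (1 : ℝ) < p := by exact_mod_cast hp.one_lt
    nlinarith
  have : ((p : ℝ) ^ 2)⁻¹ < 1 := inv_lt_one_of_one_lt₀ hp1
  linarith

/-- `σ(N)/N = ∏_{p ∣ N} σ(p^{a_p})/p^{a_p}` (multiplicativity). [folklore] -/
theorem sigma_one_div_self_eq_prod (hN : N ≠ 0) :
    (σ 1 N : ℝ) / N =
      ∏ p ∈ N.primeFactors, (σ 1 (p ^ N.factorization p) : ℝ) / (p : ℝ) ^ N.factorization p := by
  have h1 : σ 1 N = ∏ p ∈ N.primeFactors, σ 1 (p ^ N.factorization p) := by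
    have := ArithmeticFunction.IsMultiplicative.multiplicative_factorization (σ 1)
      ArithmeticFunction.isMultiplicative_sigma hN
    rw [this, Finsupp.prod, Nat.support_factorization]
  have h2 : (N : ℝ) = ∏ p ∈ N.primeFactors, (p : ℝ) ^ N.factorization p := by
    conv_lhs => rw [← Nat.prod_factorization_pow_eq_self hN]
    rw [Finsupp.prod, Nat.support_factorization]
    push_cast
    rfl
  rw [h1, h2, Nat.cast_prod, ← Finset.prod_div_distrib]

/-- `log N = ∑_{p ∣ N} a_p log p`. [folklore] -/
theorem log_eq_sum_factorization_mul_log (hN : N ≠ 0) :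
    Real.log N = ∑ p ∈ N.primeFactors, (N.factorization p : ℝ) * Real.log p := by
  conv_lhs => rw [← Nat.prod_factorization_pow_eq_self hN]
  rw [Finsupp.prod, Nat.support_factorization, Nat.cast_prod, Real.log_prod]
  · refine Finset.sum_congr rfl fun p _ => ?_
    push_cast
    rw [Real.log_pow]
  · intro p hp
    have := (Nat.prime_of_mem_primeFactors hp).pos
    positivity

/-- With parameter `ε > 0`, the prime factors of `N` are exactly the primes `≤ P`, `P` the largest
one. [cite: AlaogluErdos1944, §3] -/
theorem IsCAParameter.primeFactors_eq_primesLE (h : IsCAParameter ε N) (hε : 0 < ε) (hN : N ≠ 0)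
    {P : ℕ} (hP : P.Prime) (hPN : P ∣ N) (hmax : ∀ p ∈ N.primeFactors, p ≤ P) :
    N.primeFactors = primesLE P := by
  ext q
  rw [Nat.mem_primeFactors, Nat.mem_primesLE]
  constructor
  · rintro ⟨hq, hqN, -⟩
    exact ⟨hmax q (Nat.mem_primeFactors.2 ⟨hq, hqN, hN⟩), hq⟩
  · rintro ⟨hqP, hq⟩
    exact ⟨hq, h.dvd_of_prime_le hε hN hP hPN hq hqP, hN⟩

/-- **Robin's bound for `σ(N)/N`** (Robin 1984, §3: "`σ(N)/N ≤ ∏_{x₂<p≤x}(1 − 1/p²)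
∏_{p≤x}(1 − 1/p)⁻¹`"): if the primes of `N` are those `≤ P` and every prime in `(Q, P]` has
exponent `1`, then `σ(N)/N ≤ (∏_{p ≤ P}(1 − 1/p))⁻¹ · ∏_{Q < p ≤ P}(1 − 1/p²)`.
[cite: Robin1984, §3 (proof of Thm. 1)] -/
theorem sigma_one_div_self_le_prod {P Q : ℕ} (hpf : N.primeFactors = primesLE P) (hN : N ≠ 0)
    (h1 : ∀ p ∈ primesLE P, Q < p → N.factorization p = 1) :
    (σ 1 N : ℝ) / N ≤ (∏ p ∈ primesLE P, (1 - (p : ℝ)⁻¹))⁻¹ *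
        ∏ p ∈ (primesLE P).filter (Q < ·), (1 - ((p : ℝ) ^ 2)⁻¹) := by
  classical
  set A := (primesLE P).filter (Q < ·) with hA_def
  set B := (primesLE P).filter (fun p => ¬ Q < p) with hB_def
  have hsplit : ∀ f : ℕ → ℝ, ∏ p ∈ primesLE P, f p = (∏ p ∈ A, f p) * ∏ p ∈ B, f p :=
    fun f => (Finset.prod_filter_mul_prod_filter_not _ _ _).symm
  have hA : ∏ p ∈ A, (σ 1 (p ^ N.factorization p) : ℝ) / (p : ℝ) ^ N.factorization p =
      ∏ p ∈ A, ((1 - (p : ℝ)⁻¹)⁻¹ * (1 - ((p : ℝ) ^ 2)⁻¹)) := by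
    refine Finset.prod_congr rfl fun p hp => ?_
    obtain ⟨hp1, hp2⟩ := Finset.mem_filter.1 hp
    rw [h1 p hp1 hp2]
    exact sigma_one_prime_div_eq (Nat.prime_of_mem_primesLE hp1)
  have hB : ∏ p ∈ B, (σ 1 (p ^ N.factorization p) : ℝ) / (p : ℝ) ^ N.factorization p ≤
      ∏ p ∈ B, (1 - (p : ℝ)⁻¹)⁻¹ := by
    refine Finset.prod_le_prod (fun p _ => by positivity) fun p hp => ?_
    exact sigma_one_prime_pow_div_le (Nat.prime_of_mem_primesLE (Finset.mem_filter.1 hp).1) _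
  have hApos : 0 ≤ ∏ p ∈ A, ((1 - (p : ℝ)⁻¹)⁻¹ * (1 - ((p : ℝ) ^ 2)⁻¹)) := by
    refine Finset.prod_nonneg fun p hp => ?_
    have hp' := Nat.prime_of_mem_primesLE (Finset.mem_filter.1 hp).1
    exact mul_nonneg (inv_nonneg.2 (one_sub_inv_pos_of_prime hp').le)
      (one_sub_inv_sq_pos_of_prime hp').le
  rw [sigma_one_div_self_eq_prod hN, hpf]
  calc ∏ p ∈ primesLE P, (σ 1 (p ^ N.factorization p) : ℝ) / (p : ℝ) ^ N.factorization p
      = (∏ p ∈ A, ((1 - (p : ℝ)⁻¹)⁻¹ * (1 - ((p : ℝ) ^ 2)⁻¹))) *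
          ∏ p ∈ B, (σ 1 (p ^ N.factorization p) : ℝ) / (p : ℝ) ^ N.factorization p := by
        rw [hsplit, hA]
    _ ≤ (∏ p ∈ A, ((1 - (p : ℝ)⁻¹)⁻¹ * (1 - ((p : ℝ) ^ 2)⁻¹))) *
          ∏ p ∈ B, (1 - (p : ℝ)⁻¹)⁻¹ := mul_le_mul_of_nonneg_left hB hApos
    _ = (∏ p ∈ primesLE P, (1 - (p : ℝ)⁻¹))⁻¹ * ∏ p ∈ A, (1 - ((p : ℝ) ^ 2)⁻¹) := by
        rw [Finset.prod_mul_distrib, hsplit (fun p => 1 - (p : ℝ)⁻¹), mul_inv,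
          ← Finset.prod_inv_distrib, ← Finset.prod_inv_distrib]
        ring

/-- **`log N ≥ θ(P) + θ(Q)`**: if the primes of `N` are those `≤ P` and the primes `≤ Q ≤ P` have
exponent `≥ 2`. (Robin 1984, §3, uses `log N ≥ θ(x₁) + θ(x₂)`.) [cite: Robin1984, §3 (proof of Thm. 1)] -/
theorem theta_add_theta_le_log {P Q : ℕ} (hpf : N.primeFactors = primesLE P) (hN : N ≠ 0)
    (hQP : Q ≤ P) (h2 : ∀ p ∈ primesLE Q, 2 ≤ N.factorization p) :
    θ P + θ Q ≤ Real.log N := by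
  classical
  rw [log_eq_sum_factorization_mul_log hN, hpf, Chebyshev.theta_eq_sum_primesLE_log P,
    Chebyshev.theta_eq_sum_primesLE_log Q]
  have hfil : (primesLE P).filter (fun p => p ≤ Q) = primesLE Q := by
    ext p
    simp only [Finset.mem_filter, Nat.mem_primesLE]
    constructor
    · rintro ⟨⟨-, hp⟩, hpQ⟩
      exact ⟨hpQ, hp⟩
    · rintro ⟨hpQ, hp⟩
      exact ⟨⟨hpQ.trans hQP, hp⟩, hpQ⟩
  have key : ∑ p ∈ primesLE P, (Real.log p + if p ≤ Q then Real.log p else 0) ≤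
      ∑ p ∈ primesLE P, (N.factorization p : ℝ) * Real.log p := by
    refine Finset.sum_le_sum fun p hp => ?_
    have hp' := Nat.prime_of_mem_primesLE hp
    have hlogp : 0 ≤ Real.log p := Real.log_nonneg (by exact_mod_cast hp'.one_lt.le)
    split_ifs with hpQ
    · have : (2 : ℝ) ≤ N.factorization p := by
        exact_mod_cast h2 p (Nat.mem_primesLE.2 ⟨hpQ, hp'⟩)
      nlinarith
    · have hpN : p ∣ N := Nat.dvd_of_mem_primeFactors (hpf ▸ hp)
      have : (1 : ℝ) ≤ N.factorization p := by
        exact_mod_cast hp'.factorization_pos_of_dvd hN hpN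
      nlinarith
  rw [Finset.sum_add_distrib, ← Finset.sum_filter, hfil] at key
  exact key

/-- **The size of `N` is governed by its largest prime**: with parameter `ε > 0` and largest prime
`P`, `log N ≤ θ(P) + √u · log u` where `u = (2P+1) log(2P)/log 2` (each prime power of `N` is
`≤ 1/(ε log 2) ≤ u` by `pow_factorization_mul_le_one` and Bertrand's postulate, and the primes of
exponent `≥ 2` are `≤ √u` in number). [cite: AlaogluErdos1944, §3] -/
theorem IsCAParameter.log_le_theta_add (h : IsCAParameter ε N) (hε : 0 < ε) (hN : N ≠ 0)
    {P : ℕ} (hP : P.Prime) (hPN : P ∣ N) (hmax : ∀ p ∈ N.primeFactors, p ≤ P) :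
    Real.log N ≤ θ P +
      √((2 * P + 1) * Real.log (2 * P) / Real.log 2) *
        Real.log ((2 * P + 1) * Real.log (2 * P) / Real.log 2) := by
  classical
  have hpf := h.primeFactors_eq_primesLE hε hN hP hPN hmax
  have hlog2 : 0 < Real.log 2 := Real.log_pos one_lt_two
  -- the parameter is at most `log(3/2)/log 2 < 1/log 2`, since `2 ∣ N`
  have h2N : 2 ∣ N := h.dvd_of_prime_le hε hN hP hPN Nat.prime_two hP.two_le
  have hεlog2 : ε * Real.log 2 < 1 := by
    have h1 : ((2 : ℕ) : ℝ) ^ ε ≤ 1 + ((2 : ℕ) : ℝ)⁻¹ := h.rpow_le_one_add_inv hN Nat.prime_two h2N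
    push_cast at h1
    have h2 : Real.log ((2 : ℝ) ^ ε) ≤ Real.log (1 + (2 : ℝ)⁻¹) :=
      Real.log_le_log (Real.rpow_pos_of_pos (by norm_num) ε) h1
    rw [Real.log_rpow (by norm_num)] at h2
    have h3 : Real.log (1 + (2 : ℝ)⁻¹) < 1 := by
      have := Real.log_le_sub_one_of_pos (x := (1 + (2 : ℝ)⁻¹)) (by norm_num)
      linarith
    linarith
  set u' : ℝ := 1 / (ε * Real.log 2) with hu'
  have hu'1 : 1 ≤ u' := by
    rw [hu', le_div_iff₀ (by positivity)]
    linarith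
  have hu'0 : 0 < u' := by linarith
  -- Bertrand: a prime `P' ∈ (P, 2P]`, which does not divide `N`
  obtain ⟨P', hP', hPP', hP'2⟩ := Nat.exists_prime_lt_and_le_two_mul P hP.ne_zero
  have hP'N : ¬ P' ∣ N := fun hd =>
    absurd (hmax P' (Nat.mem_primeFactors.2 ⟨hP', hd, hN⟩)) (not_le.2 hPP')
  have hεlow := h.inv_le_eps hN hP' hP'N
  set u : ℝ := (2 * P + 1) * Real.log (2 * P) / Real.log 2 with hu
  have hP1 : (1 : ℝ) < P := by exact_mod_cast hP.one_lt
  have hu'u : u' ≤ u := by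
    -- `1/ε ≤ (P'+1) log P' ≤ (2P+1) log(2P)`
    have hlogP' : 0 < Real.log P' := Real.log_pos (by exact_mod_cast hP'.one_lt)
    have h1 : 1 / ε ≤ ((P' : ℝ) + 1) * Real.log P' := by
      rw [div_le_iff₀ hε]
      have := mul_le_mul_of_nonneg_left hεlow (by positivity : (0 : ℝ) ≤ ((P' : ℝ) + 1) * Real.log P')
      rwa [mul_one_div_cancel (by positivity)] at this
    have h2 : ((P' : ℝ) + 1) * Real.log P' ≤ (2 * P + 1) * Real.log (2 * P) := by
      have hc : (P' : ℝ) ≤ 2 * P := by exact_mod_cast hP'2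
      gcongr
      · exact_mod_cast hP'.pos
    rw [hu', hu, ← div_div]
    exact div_le_div_of_nonneg_right (h1.trans h2) hlog2.le
  have hu1 : 1 ≤ u := hu'1.trans hu'u
  -- every prime power of `N` is `≤ u'`
  have hpow : ∀ p ∈ primesLE P, ((p : ℝ) ^ N.factorization p) ≤ u' := by
    intro p hp
    have hp' := Nat.prime_of_mem_primesLE hp
    have hpN : p ∣ N := Nat.dvd_of_mem_primeFactors (hpf ▸ hp)
    have h1 := h.pow_factorization_mul_le_one hN hp' hpN
    have hlogp : Real.log 2 ≤ Real.log p :=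
      Real.log_le_log (by norm_num) (by exact_mod_cast hp'.two_le)
    have hpa : (0 : ℝ) < (p : ℝ) ^ N.factorization p := by
      have := hp'.pos
      positivity
    rw [hu', le_div_iff₀ (by positivity)]
    calc (p : ℝ) ^ N.factorization p * (ε * Real.log 2)
        ≤ (p : ℝ) ^ N.factorization p * (ε * Real.log p) := by gcongr
      _ ≤ 1 := h1
  -- the primes with exponent `≥ 2` are at most `√u'` in number
  set S2 := (primesLE P).filter (fun p => 2 ≤ N.factorization p) with hS2
  have hcard : (S2.card : ℝ) ≤ √u' := by
    have hsub : S2 ⊆ Finset.Icc 1 ⌊√u'⌋₊ := by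
      intro p hp
      obtain ⟨hp1, hp2⟩ := Finset.mem_filter.1 hp
      have hp' := Nat.prime_of_mem_primesLE hp1
      rw [Finset.mem_Icc]
      refine ⟨hp'.one_lt.le, Nat.le_floor ?_⟩
      -- `p² ≤ p^{a_p} ≤ u'`
      have hsq : (p : ℝ) ^ 2 ≤ u' := by
        calc (p : ℝ) ^ 2 ≤ (p : ℝ) ^ N.factorization p :=
              pow_le_pow_right₀ (by exact_mod_cast hp'.one_lt.le) hp2
          _ ≤ u' := hpow p hp1
      calc (p : ℝ) = √((p : ℝ) ^ 2) := by rw [Real.sqrt_sq (by positivity)]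
        _ ≤ √u' := Real.sqrt_le_sqrt hsq
    calc (S2.card : ℝ) ≤ ((Finset.Icc 1 ⌊√u'⌋₊).card : ℝ) := by
          exact_mod_cast Finset.card_le_card hsub
      _ = ⌊√u'⌋₊ := by rw [Nat.card_Icc]; push_cast; ring
      _ ≤ √u' := Nat.floor_le (Real.sqrt_nonneg _)
  -- `log N = θ(P) + Σ (a_p - 1) log p ≤ θ(P) + #S2 · log u'`
  have hlogu' : 0 ≤ Real.log u' := Real.log_nonneg hu'1
  have hmain : Real.log N ≤ θ P + S2.card * Real.log u' := by
    rw [log_eq_sum_factorization_mul_log hN, hpf, Chebyshev.theta_eq_sum_primesLE_log P]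
    have hterm : ∀ p ∈ primesLE P, (N.factorization p : ℝ) * Real.log p ≤
        Real.log p + if 2 ≤ N.factorization p then Real.log u' else 0 := by
      intro p hp
      have hp' := Nat.prime_of_mem_primesLE hp
      have hpN : p ∣ N := Nat.dvd_of_mem_primeFactors (hpf ▸ hp)
      have ha1 : 1 ≤ N.factorization p := hp'.factorization_pos_of_dvd hN hpN
      have hlogp : 0 ≤ Real.log p := Real.log_nonneg (by exact_mod_cast hp'.one_lt.le)
      split_ifs with ha2
      · -- `a log p = log (p^a) ≤ log u'`
        have hpa : (0 : ℝ) < (p : ℝ) ^ N.factorization p := by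
          have := hp'.pos
          positivity
        have : (N.factorization p : ℝ) * Real.log p ≤ Real.log u' := by
          rw [← Real.log_pow]
          exact Real.log_le_log hpa (hpow p hp)
        linarith
      · have ha : N.factorization p = 1 := by omega
        rw [ha]
        simp
    calc ∑ p ∈ primesLE P, (N.factorization p : ℝ) * Real.log p
        ≤ ∑ p ∈ primesLE P, (Real.log p + if 2 ≤ N.factorization p then Real.log u' else 0) :=
          Finset.sum_le_sum hterm
      _ = (∑ p ∈ primesLE P, Real.log p) + S2.card * Real.log u' := by
          rw [Finset.sum_add_distrib, ← Finset.sum_filter, Finset.sum_const, nsmul_eq_mul]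
  -- monotonicity in `u' ≤ u`
  have hsq : √u' * Real.log u' ≤ √u * Real.log u :=
    mul_le_mul (Real.sqrt_le_sqrt hu'u) (Real.log_le_log hu'0 hu'u) hlogu' (Real.sqrt_nonneg _)
  calc Real.log N ≤ θ P + S2.card * Real.log u' := hmain
    _ ≤ θ P + √u' * Real.log u' := by gcongr
    _ ≤ θ P + √u * Real.log u := by linarith

/-! ### The package consumed by Robin's argument -/

/-- **Structure of a colossally abundant number** (Alaoglu–Erdős 1944, §3; Robin 1984, §3): for a
colossally abundant `N` there are a parameter `ε > 0`, its largest prime `P = x₁` and a number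
`Q` (`= x₂`, the largest prime of exponent `≥ 2`, or `1` if `N` is squarefree), `1 ≤ Q ≤ P`,
such that the primes of `N` are exactly the primes `≤ P`, the primes `≤ Q` have exponent `≥ 2`
and those in `(Q, P]` exponent `1`; consequently
`σ(N)/N ≤ (∏_{p≤P}(1 − 1/p))⁻¹ ∏_{Q<p≤P}(1 − 1/p²)`, `θ(P) + θ(Q) ≤ log N`, and
`log N ≤ θ(P) + √u log u`, `u = (2P+1) log(2P)/log 2`.
[cite: Robin1984, §3 (proof of Thm. 1: σ(N)/N ≤ ∏_{x₂<p≤x}(1−p⁻²)∏_{p≤x}(1−1/p)⁻¹)] -/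
theorem ColossallyAbundant.exists_structure (hN : ColossallyAbundant N) :
    ∃ ε : ℝ, ∃ P Q : ℕ, 0 < ε ∧ IsCAParameter ε N ∧ P.Prime ∧ P ∣ N ∧ 1 ≤ Q ∧ Q ≤ P ∧
      N.primeFactors = primesLE P ∧
      (∀ p ∈ primesLE Q, 2 ≤ N.factorization p) ∧
      (∀ p ∈ primesLE P, Q < p → N.factorization p = 1) ∧
      (σ 1 N : ℝ) / N ≤ (∏ p ∈ primesLE P, (1 - (p : ℝ)⁻¹))⁻¹ *
          ∏ p ∈ (primesLE P).filter (Q < ·), (1 - ((p : ℝ) ^ 2)⁻¹) ∧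
      θ P + θ Q ≤ Real.log N ∧
      Real.log N ≤ θ P +
        √((2 * P + 1) * Real.log (2 * P) / Real.log 2) *
          Real.log ((2 * P + 1) * Real.log (2 * P) / Real.log 2) := by
  classical
  obtain ⟨h2N, ε, hε, hpar⟩ := hN
  have hpar' : IsCAParameter ε N := hpar
  have hN0 : N ≠ 0 := by omega
  have hne : N.primeFactors.Nonempty := Nat.nonempty_primeFactors.2 (by omega)
  set P := N.primeFactors.max' hne with hP_def
  have hPmem : P ∈ N.primeFactors := Finset.max'_mem _ _
  have hP : P.Prime := Nat.prime_of_mem_primeFactors hPmem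
  have hPN : P ∣ N := Nat.dvd_of_mem_primeFactors hPmem
  have hmax : ∀ p ∈ N.primeFactors, p ≤ P := fun p hp => Finset.le_max' _ p hp
  have hpf := hpar'.primeFactors_eq_primesLE hε hN0 hP hPN hmax
  have hsize := hpar'.log_le_theta_add hε hN0 hP hPN hmax
  set S2 := (primesLE P).filter (fun p => 2 ≤ N.factorization p) with hS2
  by_cases hS : S2.Nonempty
  · set Q := S2.max' hS with hQ_def
    have hQmem : Q ∈ S2 := Finset.max'_mem _ _
    obtain ⟨hQ1, hQ2⟩ := Finset.mem_filter.1 hQmem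
    have hQ : Q.Prime := Nat.prime_of_mem_primesLE hQ1
    have hQP : Q ≤ P := Nat.le_of_mem_primesLE hQ1
    have hexp2 : ∀ p ∈ primesLE Q, 2 ≤ N.factorization p := by
      intro p hp
      obtain ⟨hpQ, hp'⟩ := Nat.mem_primesLE.1 hp
      exact hQ2.trans (hpar'.factorization_antitone hε hN0 hp' hQ hpQ)
    have hexp1 : ∀ p ∈ primesLE P, Q < p → N.factorization p = 1 := by
      intro p hp hQp
      have hp' := Nat.prime_of_mem_primesLE hp
      have hpN : p ∣ N := Nat.dvd_of_mem_primeFactors (hpf ▸ hp)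
      have ha1 : 1 ≤ N.factorization p := hp'.factorization_pos_of_dvd hN0 hpN
      have ha2 : ¬ 2 ≤ N.factorization p := fun h2 =>
        absurd (Finset.le_max' S2 p (Finset.mem_filter.2 ⟨hp, h2⟩)) (not_le.2 hQp)
      omega
    exact ⟨ε, P, Q, hε, hpar', hP, hPN, hQ.one_lt.le, hQP, hpf, hexp2, hexp1,
      sigma_one_div_self_le_prod hpf hN0 hexp1, theta_add_theta_le_log hpf hN0 hQP hexp2, hsize⟩
  · have hexp1 : ∀ p ∈ primesLE P, 1 < p → N.factorization p = 1 := by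
      intro p hp _
      have hp' := Nat.prime_of_mem_primesLE hp
      have hpN : p ∣ N := Nat.dvd_of_mem_primeFactors (hpf ▸ hp)
      have ha1 : 1 ≤ N.factorization p := hp'.factorization_pos_of_dvd hN0 hpN
      have ha2 : ¬ 2 ≤ N.factorization p := fun h2 => hS ⟨p, Finset.mem_filter.2 ⟨hp, h2⟩⟩
      omega
    have hexp2 : ∀ p ∈ primesLE 1, 2 ≤ N.factorization p := by simp
    exact ⟨ε, P, 1, hε, hpar', hP, hPN, le_rfl, hP.one_lt.le, hpf, hexp2, hexp1,
      sigma_one_div_self_le_prod hpf hN0 hexp1, theta_add_theta_le_log hpf hN0 hP.one_lt.le hexp2,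
      hsize⟩

end Nat
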